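import Summits.SmoothPoincare4.SmoothPoincare4.Theorems.SymplecticOrigamiOrigamiFoldExistenceStubOuterSideLemmaSheet
import Summits.SmoothPoincare4.SmoothPoincare4.Theorems.SymplecticOrigamiOrigamiFoldExistenceStubOuterCleanRecognitionChartSide
import Summits.SmoothPoincare4.SmoothPoincare4.Theorems.SymplecticOrigamiOrigamiFoldExistenceStubOuterSideLemmaCollarSide
import Summits.SmoothPoincare4.SmoothPoincare4.Theorems.SymplecticOrigamiOrigamiFoldExistenceStubOuterSideLemmaExteriorW
import Summits.SmoothPoincare4.SmoothPoincare4.Theorems.SymplecticOrigamiOrigamiFoldExistenceStubOuterCleanRecognitionChartCapMap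
import Summits.SmoothPoincare4.SmoothPoincare4.Theorems.SymplecticOrigamiOrigamiFoldExistenceStubOuterSideLemmaCapImmersive
import Literature.Topology.FourManifolds.HomotopyS4CompactProofs
import Literature.Topology.FourManifolds.HomotopyS4SimplyConnected
import Literature.Topology.FourManifolds.SphereSimplyConnected

/-!
# Stub `stub_outerSideLemma` of line `shadow-pleats` for crux `OrigamiFoldExistence` — ε:
# THE OUTER SIDE LEMMA (O1) by coverings and Brown's theorem — ε₂: the contradiction and the statement
(item stmt-SmoothPoincare4-7844, route SymplecticOrigami; seat c5, complementary lead; skeleton r8,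
`Cruxes/OrigamiFoldExistence/Lines/shadow_pleats.lean`, registry holder seat c4)

The registered stub O1 `stub_outerSideLemma : OuterSideLemma` (tree def `OuterSideLemma`, file F
`…StubOuterCleanRecognitionChartSide`) was filed by skeleton r7/r8 and by `OuterClean-analysis-c3.md` §2 as a
DEGREE-THEORY DEBT (normal degree of immersed `S³ ↬ ℝ⁴`, Hopf's `deg Gauss = χ`).  This file proves it
WITHOUT degree theory and WITHOUT further hypotheses (the cap map of files N/O′ — the hypotheses `hCs hCband hCd hCim`
of file Q `…ChartPsi` — is in the tree: N = `capMap δ`, O′ = its immersivity on the cap):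

* `liftS4_chartShadow_mem_exterior` — THE CORE.  For a compact connected `M` in a `1`-chart pleated position,
  tube data `D` of the lifted outer crease, a cap map `C` and an O1-free collar package `(κ, t₀, s)` (file γ
  `exists_collarSide`: the open outer collar is lifted into the side `{s · D.sideFun > 0}`, with local
  surjectivity onto that side), the open outer collar is lifted into the EXTERIOR `{sideσ D > 0}` of the crease.
  PROOF.  If not, the collar goes into the chimney `{sideσ D < 0}`, and file ε₁ `…StubOuterSideLemmaSheet`
  (`exists_sheet_of_collar_chimney`: the covering `Ψ|K → chimney`, Brown's theorem for the simple connectivity of the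
  chimney, the lifting criterion) gives an open `S ⊆ Kₒ = M ∖ e₀(B̄₂)` containing the collar, mapped injectively into
  the chimney by `Ψ = psiMap ι δ C`, relatively closed over the chimney.  Then `closure S ⊆ S ∪ e₀(B̄₂)`: a limit
  point over the chimney is in `S`, over the exterior impossible, and over the crease impossible — near such a
  far-sheet point every chimney value in the tube is the lifted shadow of a collar point of radius `≤ 2 + κ/2` (local
  surjectivity), which injectivity of `Ψ` on `S` forbids.  So `X = S ∪ e₀(B̄₂)` is clopen, nonempty, and misses the
  round point over the north pole (`hCim`: `Ψ = C` sends it to `N ∈ exterior`) — contradicting the connectedness of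
  `M`.
* `outerSideLemma_of_capMaps` — `OuterSideLemma` from the existence of cap maps (compactness and simple
  connectivity of a homotopy `4`-sphere: `compactSpace_of_homotopyEquiv_sphere_four_holds`,
  `simplyConnectedSpace_of_homotopyEquiv_sphere_four` + `simplyConnectedSpace_sphere_four_holds`; tube data
  `nonempty_tubeData (isSmoothEmbedding_liftedCrease …)`; file δ `exists_W_of_mem_exterior` for the unbounded
  connected `W`).
* `outerSideLemma_of_capImmersive` — the same with `C = capMap δ` (file N: `contMDiffAt_capMap`,
  `capMap_eq_liftS4_proj5`, `image_capMap`), leaving exactly cap immersivity as hypothesis;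
* `stub_outerSideLemma : OuterSideLemma` — THE REGISTERED STUB, closed with file O′
  `eq_zero_of_mfderiv_capMap_eq_zero` (`…StubOuterSideLemmaCapImmersive`).

Sources: the lead's `Cruxes/OrigamiFoldExistence/SideLemma-covering-c5.md`; A. Hatcher, *Algebraic Topology*
(2002) Prop. 1.33 (lifting criterion); R. J. Daverman, *Decompositions of manifolds* (1986) Thm. II.6.6 (Brown);
`OuterClean-analysis-c3.md` §2 (the statement O1 and its degree-theoretic proof, not used).
-/

noncomputable section

-- the prescribed namespace `Summit.<P>.<Sub>.…` duplicates `SmoothPoincare4` (P = Sub)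
set_option linter.dupNamespace false

open scoped Manifold ContDiff Topology RealInnerProductSpace
open Set Function Filter Metric
open Literature.Topology.FourManifolds Literature.Topology.FourManifolds.SphereHypersurfaceSides


namespace Summit.SmoothPoincare4.SmoothPoincare4.Theorems.OrigamiFoldExistence.ShadowPleats


/-! ### The side of the collar is the exterior -/

section Core

variable {M : Type} [TopologicalSpace M] [T2Space M] [ChartedSpace (EuclideanSpace ℝ (Fin 4)) M]
  [IsManifold (𝓡 4) ∞ M]
  {ι : M → EuclideanSpace ℝ (Fin 5)} {δ : ℝ} {e : Fin 1 → EuclideanSpace ℝ (Fin 4) → M}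
  {C : EuclideanSpace ℝ (Fin 5) → Metric.sphere (0 : EuclideanSpace ℝ (Fin 5)) 1}

/-- In the tube, near the core, the side function IS the fibre coordinate. -/
theorem sideFun_tube {f : Metric.sphere (0 : EuclideanSpace ℝ (Fin 4)) 1 → Metric.sphere (0 : EuclideanSpace ℝ (Fin 5)) 1}
    (D : TubeData f) (x : Metric.sphere (0 : EuclideanSpace ℝ (Fin 4)) 1) (w : EuclideanSpace ℝ (Fin 1))
    (hw : |w 0| ≤ 1 / 4) : D.sideFun (D.τ (x, w)) = w 0 := by
  have hw' : w 0 ∈ Icc (-1 : ℝ) 1 := by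
    constructor <;> linarith [abs_le.1 hw]
  rw [D.apply_eq_collar x w hw', D.sideFun_collar (by norm_num), satProfile_eq_self hw]

/-- **THE CORE OF O1.**  For a compact connected `M` in a `1`-chart pleated position with outer-clean chart,
tube data `D` of the lifted crease, a cap map `C`, and an O1-free collar package `(κ, t₀, s)`: the collar sign
`s` is the pole sign, i.e. the open outer collar is lifted into the EXTERIOR of the crease.  Proof: if the collar
went into the chimney, the sheet of file ε₁ through a collar point together with the closed chart ball would be a
nonempty proper clopen subset of `M`. [folklore] -/
theorem liftS4_chartShadow_mem_exterior [CompactSpace M] [ConnectedSpace M]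
    (hpos : IsPleatedPosition ι δ e) (D : TubeData (liftedCrease ι (e 0)))
    (hCs : ∀ p : EuclideanSpace ℝ (Fin 5), p 4 < 1 →
      ContMDiffAt 𝓘(ℝ, EuclideanSpace ℝ (Fin 5)) (𝓡 4) ∞ C p)
    (hCband : ∀ p : EuclideanSpace ℝ (Fin 5), ‖p‖ = 1 → (1 - δ) / 2 ≤ p 4 → p 4 < 1 →
      C p = liftS4 (proj5 p))
    (hCd : ∀ p : EuclideanSpace ℝ (Fin 5), ‖p‖ = 1 → p 4 ≤ 1 - δ → ∀ w : EuclideanSpace ℝ (Fin 5),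
      ⟪p, w⟫ = 0 → mfderiv 𝓘(ℝ, EuclideanSpace ℝ (Fin 5)) (𝓡 4) C p w = 0 → w = 0)
    (hCim : C '' {q : EuclideanSpace ℝ (Fin 5) | ‖q‖ = 1 ∧ q 4 ≤ 1 - δ} =
      (liftS4 '' Metric.ball 0 (Real.sqrt (1 - (1 - δ) ^ 2)))ᶜ)
    {κ t₀ s : ℝ} (ht₀ : 0 < t₀) (ht₀1 : t₀ ≤ 1 / 4) (hs : s = 1 ∨ s = -1)
    (hside : ∀ u : EuclideanSpace ℝ (Fin 4), 2 < ‖u‖ → ‖u‖ < 2 + κ →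
      0 < s * D.sideFun (liftS4 ((proj5 ∘ ι ∘ e 0) u)))
    (hsurj : ∀ (x : Metric.sphere (0 : EuclideanSpace ℝ (Fin 4)) 1) (t : ℝ), 0 ≤ s * t → s * t ≤ t₀ →
      ∃ u : EuclideanSpace ℝ (Fin 4), 2 ≤ ‖u‖ ∧ ‖u‖ ≤ 2 + κ / 2 ∧
        liftS4 ((proj5 ∘ ι ∘ e 0) u) = D.τ (x, t • SphereHypersurfaceSides.e₀))
    {u : EuclideanSpace ℝ (Fin 4)} (hu2 : 2 < ‖u‖) (huκ : ‖u‖ < 2 + κ) :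
    liftS4 ((proj5 ∘ ι ∘ e 0) u) ∈ exterior D := by
  classical
  set G : EuclideanSpace ℝ (Fin 4) → EuclideanSpace ℝ (Fin 4) := proj5 ∘ ι ∘ e 0 with hGdef
  have hN : northPole ∉ range (liftedCrease ι (e 0)) := northPole_notMem_range_liftedCrease ι (e 0)
  have hpos' := hpos
  obtain ⟨hι, hδ, hδ1, hround, hcharts, -, -, -⟩ := hpos'
  have he : Manifold.IsSmoothEmbedding (𝓡 4) (𝓡 4) ∞ (e 0) := (hcharts 0).1
  have heinj : Injective (e 0) := he.isEmbedding.injective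
  have hecont : Continuous (e 0) := he.contMDiff.continuous
  have heopen : IsOpenMap (e 0) := isOpenMap_pleatChart he
  have habove : ∀ v, 1 - δ < ι (e 0 v) 4 := (hcharts 0).2
  -- the structure map
  set Ψ : M → Metric.sphere (0 : EuclideanSpace ℝ (Fin 5)) 1 := psiMap ι δ C with hΨdef
  have hΨcont : Continuous Ψ := (contMDiff_psiMap hι hδ hδ1 hround hCs hCband).continuous
  have hΨe : ∀ v, Ψ (e 0 v) = liftS4 (G v) := fun v => psiMap_of_lt (habove v)
  have hcrease : ∀ v : EuclideanSpace ℝ (Fin 4), ‖v‖ = 2 → liftS4 (G v) ∈ range (liftedCrease ι (e 0)) := by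
    intro v hv
    rw [range_liftedCrease]
    exact ⟨v, mem_sphere_zero_iff_norm.2 hv, rfl⟩
  -- the pole sign is `±1`; if `s` is the pole sign we are done
  have hpole := poleSign_eq_or D hN
  by_cases hsp : s = poleSign D
  · show 0 < poleSign D * D.sideFun (liftS4 (G u))
    rw [← hsp]
    exact hside u hu2 huκ
  exfalso
  have hsneg : s = -poleSign D := by
    rcases hs with rfl | rfl <;> rcases hpole with h | h
    · exact absurd h.symm hsp
    · rw [h]; norm_num
    · rw [h]
    · exact absurd h.symm hsp
  -- BAD CASE: the collar goes into the chimney `{sideσ < 0} = {0 < s * sideFun}`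
  have hchim : ∀ z, z ∈ chimney D ↔ 0 < s * D.sideFun z := by
    intro z
    show poleSign D * D.sideFun z < 0 ↔ 0 < s * D.sideFun z
    rw [hsneg, neg_mul, neg_pos]
  have hcollar_chim : ∀ v : EuclideanSpace ℝ (Fin 4), 2 < ‖v‖ → ‖v‖ < 2 + κ → Ψ (e 0 v) ∈ chimney D := by
    intro v hv2 hvκ
    rw [hΨe, hchim]
    exact hside v hv2 hvκ
  -- the open part `Kₒ = M ∖ e₀(B̄₂)`
  set Kₒ : Set M := {m | m ∉ e 0 '' Metric.closedBall 0 2} with hKₒdef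
  have hKₒopen : IsOpen Kₒ := ((isCompact_closedBall (0 : EuclideanSpace ℝ (Fin 4)) 2).image hecont).isClosed.isOpen_compl
  /- ### the sheet through the collar (file ε₁) -/
  obtain ⟨S, hSopenM, hSKₒ, hSchim, hSinj, heΩ, hSclch⟩ :=
    exists_sheet_of_collar_chimney hpos D hCs hCband hCd hsneg hside hu2 huκ
  rw [← hΨdef] at hSchim hSinj hSclch
  /- ### the tube neighbourhood of the crease -/
  have hcoord : Continuous fun w : EuclideanSpace ℝ (Fin 1) => w 0 :=
    (EuclideanSpace.proj (0 : Fin 1)).continuous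
  set 𝒩 : Set (Metric.sphere (0 : EuclideanSpace ℝ (Fin 5)) 1) :=
    D.τ '' (univ ×ˢ {w : EuclideanSpace ℝ (Fin 1) | |w 0| < t₀}) with h𝒩def
  have h𝒩open : IsOpen 𝒩 :=
    D.isOpenEmbedding.isOpenMap _ (isOpen_univ.prod (isOpen_lt (continuous_abs.comp hcoord) continuous_const))
  have hrange𝒩 : range (liftedCrease ι (e 0)) ⊆ 𝒩 := by
    rintro _ ⟨x, rfl⟩
    refine ⟨(x, 0), ⟨mem_univ _, ?_⟩, D.apply_zero x⟩
    show |(0 : EuclideanSpace ℝ (Fin 1)) 0| < t₀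
    simpa using ht₀
  -- a point of the chimney inside `𝒩` is the lifted shadow of a collar point of radius in `(2, 2 + κ/2]`
  have hchim𝒩 : ∀ z ∈ chimney D, z ∈ 𝒩 → ∃ v : EuclideanSpace ℝ (Fin 4), 2 < ‖v‖ ∧ ‖v‖ ≤ 2 + κ / 2 ∧
      liftS4 (G v) = z := by
    rintro z hz ⟨⟨x, w⟩, ⟨-, hw⟩, rfl⟩
    have hw' : |w 0| < t₀ := hw
    have hsf : D.sideFun (D.τ (x, w)) = w 0 := sideFun_tube D x w (by linarith [hw'.le])
    have hpos0 : 0 < s * w 0 := by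
      have := (hchim _).1 hz
      rwa [hsf] at this
    have hle : s * w 0 ≤ t₀ := by
      have : s * w 0 ≤ |w 0| := by
        rcases hs with rfl | rfl
        · rw [one_mul]; exact le_abs_self _
        · rw [neg_one_mul]; exact neg_le_abs _
      exact this.trans hw'.le
    obtain ⟨v, hv2, hvκ, hveq⟩ := hsurj x (w 0) hpos0.le hle
    rw [SphereHypersurfaceSides.smul_e₀_eq] at hveq
    refine ⟨v, lt_of_le_of_ne hv2 ?_, hvκ, hveq⟩
    intro h2
    have hvc : liftS4 (G v) ∈ range (liftedCrease ι (e 0)) := hcrease v h2.symm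
    rw [hveq] at hvc
    exact (disjoint_chimney_range D hN).le_bot ⟨hz, hvc⟩
  /- ### KEY: a far-sheet point over the crease is not in the closure of the sheet -/
  have hkey : ∀ m ∈ Kₒ, Ψ m ∈ range (liftedCrease ι (e 0)) → m ∉ closure S := by
    intro m hmKₒ hmc hmcl
    obtain ⟨φ, hmφ, hφ⟩ := isLocalHomeomorphOn_psiMap hpos hCs hCband hCd m hmKₒ
    have hφΨ : ∀ x, Ψ x = φ x := fun x => congr_fun hφ x
    set B : Set M := φ.source ∩ Ψ ⁻¹' 𝒩 ∩ (e 0 '' Metric.closedBall 0 (2 + κ / 2))ᶜ with hBdef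
    have hBopen : IsOpen B :=
      (φ.open_source.inter (h𝒩open.preimage hΨcont)).inter
        ((isCompact_closedBall (0 : EuclideanSpace ℝ (Fin 4)) (2 + κ / 2)).image hecont).isClosed.isOpen_compl
    have hmB : m ∈ B := by
      refine ⟨⟨hmφ, hrange𝒩 hmc⟩, ?_⟩
      rintro ⟨v, hv, rfl⟩
      have hv' := mem_closedBall_zero_iff.1 hv
      by_cases hv2 : ‖v‖ ≤ 2
      · exact hmKₒ ⟨v, mem_closedBall_zero_iff.2 hv2, rfl⟩
      · have hch := hcollar_chim v (not_le.1 hv2) (by linarith)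
        exact (disjoint_chimney_range D hN).le_bot ⟨hch, hmc⟩
    -- `B` misses the sheet
    have hBS : ∀ b ∈ B, b ∉ S := by
      rintro b ⟨⟨hbφ, hb𝒩⟩, hbball⟩ hbS
      obtain ⟨v, hv2, hvκ, hveq⟩ := hchim𝒩 (Ψ b) (hSchim b hbS) hb𝒩
      have hvS : e 0 v ∈ S := heΩ v hv2 (by linarith)
      have heq : e 0 v = b := hSinj hvS hbS (by rw [hΨe, hveq])
      exact hbball ⟨v, mem_closedBall_zero_iff.2 hvκ, heq⟩
    obtain ⟨b, hbB, hbS⟩ := mem_closure_iff.1 hmcl B hBopen hmB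
    exact hBS b hbB hbS
  /- ### the clopen set `X = S ∪ e₀(B̄₂)` -/
  set X : Set M := S ∪ e 0 '' Metric.closedBall 0 2 with hXdef
  have hXclosed : IsClosed X := by
    have hcl : closure S ⊆ X := by
      intro m hmcl
      by_cases hmKₒ : m ∈ Kₒ
      · rcases mem_chimney_or D (Ψ m) with hch | h0 | hex
        · -- over the chimney the sheet is relatively closed
          exact Or.inl (hSclch m hmKₒ hch hmcl)
        · exact absurd hmcl (hkey m hmKₒ ((sideσ_eq_zero_iff D hN _).1 h0))
        · exfalso
          have hO : IsOpen (Kₒ ∩ Ψ ⁻¹' exterior D) := hKₒopen.inter ((isOpen_exterior D hN).preimage hΨcont)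
          obtain ⟨b, ⟨-, hbex⟩, hbS⟩ := mem_closure_iff.1 hmcl _ hO ⟨hmKₒ, hex⟩
          exact (disjoint_chimney_exterior D).le_bot ⟨hSchim b hbS, hbex⟩
      · right
        simp only [hKₒdef, mem_setOf_eq, not_not] at hmKₒ
        exact hmKₒ
    have : closure X ⊆ X := by
      rw [hXdef, closure_union]
      exact union_subset (hcl.trans subset_rfl)
        ((((isCompact_closedBall (0 : EuclideanSpace ℝ (Fin 4)) 2).image hecont).isClosed.closure_eq).le.trans
          subset_union_right)
    exact closure_subset_iff_isClosed.1 this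
  have hXopen : IsOpen X := by
    rw [isOpen_iff_mem_nhds]
    rintro x (hxS | ⟨v, hv, rfl⟩)
    · exact mem_of_superset (hSopenM.mem_nhds hxS) subset_union_left
    · have hO : IsOpen (e 0 '' Metric.ball 0 (2 + κ)) := heopen _ isOpen_ball
      have hmem : e 0 v ∈ e 0 '' Metric.ball 0 (2 + κ) :=
        ⟨v, mem_ball_zero_iff.2 (by linarith [mem_closedBall_zero_iff.1 hv]), rfl⟩
      refine mem_of_superset (hO.mem_nhds hmem) ?_
      rintro _ ⟨v', hv', rfl⟩
      by_cases h2 : ‖v'‖ ≤ 2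
      · exact Or.inr ⟨v', mem_closedBall_zero_iff.2 h2, rfl⟩
      · exact Or.inl (heΩ v' (not_le.1 h2) (mem_ball_zero_iff.1 hv'))
  have hXne : X.Nonempty := ⟨e 0 u, Or.inl (heΩ u hu2 huκ)⟩
  -- the round point over the north pole is not in `X`
  have hXuniv : X ≠ univ := by
    have hNmem : northPole ∈ (liftS4 '' Metric.ball 0 (Real.sqrt (1 - (1 - δ) ^ 2)))ᶜ := by
      rintro ⟨y, -, hy⟩
      exact liftS4_ne_northPole y hy
    rw [← hCim] at hNmem
    obtain ⟨q, ⟨hq1, hq4⟩, hqN⟩ := hNmem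
    obtain ⟨s₀, hs₀⟩ := mem_range_of_mem_sphere hround (by simpa using hq1) hq4
    have hΨs₀ : Ψ s₀ = northPole := by
      rw [← hqN, ← hs₀]
      exact psiMap_of_le (by rw [hs₀]; exact hq4)
    intro hX
    have hs₀X : s₀ ∈ X := hX ▸ mem_univ s₀
    rcases hs₀X with hsS | ⟨v, -, hv⟩
    · have := hSchim s₀ hsS
      rw [hΨs₀] at this
      exact (disjoint_chimney_exterior D).le_bot ⟨this, northPole_mem_exterior D hN⟩
    · have h1 := habove v
      rw [hv, hs₀] at h1
      linarith
  rcases isClopen_iff.1 ⟨hXclosed, hXopen⟩ with h | h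
  · exact hXne.ne_empty h
  · exact hXuniv h

end Core

/-! ### O1: the outer side lemma -/

section Final

/-- **THE OUTER SIDE LEMMA (O1), given a cap map.**  If for every `0 < δ < 1` there is a map `C : ℝ⁵ → S⁴`
with the four properties of files N/O of the chart worker (smooth where `p₄ < 1`; equal to `λ ∘ proj5` on the
band `{(1-δ)/2 ≤ p₄ < 1}` of the round sphere; differential injective on tangent directions at cap points; the
cap `{‖p‖ = 1, p₄ ≤ 1-δ}` mapped onto `S⁴ ∖ λ(B_ρ)`), then `OuterSideLemma` holds: for a homotopy `4`-sphere in
a `1`-chart pleated round-rim position with outer-clean chart, the two germs born at the outer crease lie on its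
UNBOUNDED side.  No degree theory: compactness and simple connectivity of `M`, the covering `Ψ|K → chimney`
(Mathlib `IsCoveringMapOn.of_isLocalHomeomorphOn`), Brown's generalized Schoenflies theorem (tree) for the simple
connectivity of the chimney, the lifting criterion, and the first-order collar package. [folklore] -/
theorem outerSideLemma_of_capMaps
    (hC : ∀ δ : ℝ, 0 < δ → δ < 1 →
      ∃ C : EuclideanSpace ℝ (Fin 5) → Metric.sphere (0 : EuclideanSpace ℝ (Fin 5)) 1,
        (∀ p : EuclideanSpace ℝ (Fin 5), p 4 < 1 →
          ContMDiffAt 𝓘(ℝ, EuclideanSpace ℝ (Fin 5)) (𝓡 4) ∞ C p) ∧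
        (∀ p : EuclideanSpace ℝ (Fin 5), ‖p‖ = 1 → (1 - δ) / 2 ≤ p 4 → p 4 < 1 →
          C p = liftS4 (proj5 p)) ∧
        (∀ p : EuclideanSpace ℝ (Fin 5), ‖p‖ = 1 → p 4 ≤ 1 - δ → ∀ w : EuclideanSpace ℝ (Fin 5),
          ⟪p, w⟫ = 0 → mfderiv 𝓘(ℝ, EuclideanSpace ℝ (Fin 5)) (𝓡 4) C p w = 0 → w = 0) ∧
        C '' {q : EuclideanSpace ℝ (Fin 5) | ‖q‖ = 1 ∧ q 4 ≤ 1 - δ} =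
          (liftS4 '' Metric.ball 0 (Real.sqrt (1 - (1 - δ) ^ 2)))ᶜ) :
    OuterSideLemma := by
  intro M _ _ _ _ _ hM ι δ e hpos hclean η hη
  haveI : CompactSpace M := compactSpace_of_homotopyEquiv_sphere_four_holds M hM
  haveI : SimplyConnectedSpace M :=
    simplyConnectedSpace_of_homotopyEquiv_sphere_four simplyConnectedSpace_sphere_four_holds M hM
  have hpos' := hpos
  obtain ⟨hι, hδ, hδ1, -⟩ := hpos'
  haveI : T2Space M := hι.isEmbedding.t2Space
  obtain ⟨C, hCs, hCband, hCd, hCim⟩ := hC δ hδ hδ1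
  have hf := isSmoothEmbedding_liftedCrease hpos hclean
  obtain ⟨D⟩ := nonempty_tubeData hf
  obtain ⟨κ, t₀, s, hκ, -, ht₀, ht₀1, hs, -, hside, hsurj⟩ := exists_collarSide hpos hclean D
  -- a collar point of radius `2 + min κ η / 2`
  set r : ℝ := 2 + min κ η / 2 with hr
  have hmin : 0 < min κ η := lt_min hκ hη
  set u : EuclideanSpace ℝ (Fin 4) := r • EuclideanSpace.single (0 : Fin 4) (1 : ℝ) with hu
  have hnorm : ‖u‖ = r := by
    rw [hu, norm_smul]
    simp [abs_of_pos (show (0 : ℝ) < r by linarith)]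
  have hu2 : 2 < ‖u‖ := by rw [hnorm]; linarith
  have huκ : ‖u‖ < 2 + κ := by rw [hnorm]; linarith [min_le_left κ η]
  have huη : ‖u‖ < 2 + η := by rw [hnorm]; linarith [min_le_right κ η]
  have hext : liftS4 ((proj5 ∘ ι ∘ e 0) u) ∈ exterior D :=
    liftS4_chartShadow_mem_exterior hpos D hCs hCband hCd hCim ht₀ ht₀1 hs hside hsurj hu2 huκ
  obtain ⟨W, hWc, huW, hWd, hWb⟩ := exists_W_of_mem_exterior (G := proj5 ∘ ι ∘ e 0) D hext
  exact ⟨u, hu2, huη, W, hWc, huW, hWd, hWb⟩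

/-- **O1 GIVEN CAP IMMERSIVITY.**  With the chart worker's cap map `capMap δ` (file N `…ChartCapMap`, p125831:
`contMDiffAt_capMap`, `capMap_eq_liftS4_proj5`, `image_capMap`) the only input left is its immersivity on the
cap in the `ℝ⁵`-calculus form of file Q (file O): `OuterSideLemma` follows from that one statement. [folklore] -/
theorem outerSideLemma_of_capImmersive
    (hO : ∀ δ : ℝ, 0 < δ → δ < 1 → ∀ p : EuclideanSpace ℝ (Fin 5), ‖p‖ = 1 → p 4 ≤ 1 - δ →
      ∀ w : EuclideanSpace ℝ (Fin 5), ⟪p, w⟫ = 0 →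
        mfderiv 𝓘(ℝ, EuclideanSpace ℝ (Fin 5)) (𝓡 4) (capMap δ) p w = 0 → w = 0) :
    OuterSideLemma :=
  outerSideLemma_of_capMaps fun δ hδ hδ1 =>
    ⟨capMap δ, fun _ hp => contMDiffAt_capMap hδ1 hp,
      fun _ hp1 hb hp4 => capMap_eq_liftS4_proj5 hδ1 hp1 hp4 hb, hO δ hδ hδ1, image_capMap hδ hδ1⟩

/-- **STUB O1 `stub_outerSideLemma` — CLOSED.**  The registered stub of skeleton r7/r8 of the line `shadow-pleats`
(`Cruxes/OrigamiFoldExistence/Lines/shadow_pleats.lean`), verbatim: the outer side lemma holds.  Cap immersivity is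
the chart worker's file O′ `eq_zero_of_mfderiv_capMap_eq_zero` (`…StubOuterSideLemmaCapImmersive`, p128297); everything
else is above.  No degree theory, no Hopf, no `χ`. [folklore] -/
theorem stub_outerSideLemma : OuterSideLemma :=
  outerSideLemma_of_capImmersive fun _ hδ hδ1 _ hp1 hp4 _ hpw h0 =>
    eq_zero_of_mfderiv_capMap_eq_zero hδ hδ1 hp1 hp4 hpw h0

end Final

end Summit.SmoothPoincare4.SmoothPoincare4.Theorems.OrigamiFoldExistence.ShadowPleats

end
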